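import Summits.NavierStokesRegularity.NavierStokesRegularity.Theorems.LinearLiouvilleSeven.Negative.NormalForm

/-!
# `LinearLiouvilleSeven`: the backward decay of the tempered class is load-bearing (affine modes)

Negative-side support for crux stmt-NavierStokesRegularity-4054 (cdisprove seat). The tempered
velocity bound `‖v‖ ≤ K/√(−t) + K(1+‖x‖)/(−t)` forces `v → 0` as `t → −∞`. Weakening it to
locally-uniform linear growth `‖v‖ ≤ K(1 + (−t)⁻¹)(1 + ‖x‖)` — implied by it,
`sevenLinearGrowth_of_sevenTempered`, all other clauses verbatim — admits the time-independent
linear modes `v = Lx`, `tr L = 0`, `q = 0`, seven of which are independent modulo slice-constants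
already at `u = 0` (`affFamily_indep_modSlice`): `linearLiouvilleSeven_false_without_backward_decay`.
This is the checked form of the crux docstring's remark that the affine modes `M(t)x` are excluded
only by the behaviour of the class as `t → −∞`.

## References

* G. Koch, N. Nadirashvili, G. Seregin, V. Šverák, Acta Math. 203 (2009), §1 (parasitic solutions
  `b(t)`, `−b′(t)·x`), (1.4), Prop. 4.1, Remark 6.1. [KNSS2009]
* C. R. Doering, J. D. Gibbon, *Applied Analysis of the Navier–Stokes Equations*, CUP 1995, §9.3
  (9.3.2) (the linearised system). [DoeringGibbon1995]
-/

noncomputable section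

open Set Function MeasureTheory InnerProductSpace
open scoped Laplacian ContDiff Topology RealInnerProductSpace BigOperators

set_option linter.dupNamespace false

namespace Summit.NavierStokesRegularity.NavierStokesRegularity.Theorems.LinearLiouvilleSeven.Negative

open Literature.Analysis Literature.Analysis.FluidPDE
open Summit.NavierStokesRegularity.NavierStokesRegularity.Theses.SymmetryModuliCount

/-! ## Load-bearing (b): the backward decay built into "tempered" (affine modes)

The velocity bound `‖v‖ ≤ K/√(−t) + K(1+‖x‖)/(−t)` forces `v → 0` as `t → −∞`. Weakening it to
locally-uniform linear growth `‖v‖ ≤ K(1 + (−t)⁻¹)(1 + ‖x‖)` (which it implies, see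
`sevenLinearGrowth_of_sevenTempered`) lets in the time-independent linear modes `v = Lx`,
`tr L = 0`, `q = 0`, seven of which are independent modulo slice-constants — already at `u = 0`.
So any proof must use the decay of the tempered class at `t = −∞` (this is what kills the affine
modes `M x`; cf. the crux docstring). -/

/-- The seven-family hypothesis with the velocity growth weakened to locally-uniform linear growth
(no decay as `t → −∞`); the other four clauses verbatim. -/
def SevenLinearGrowth (u : ℝ → E3 → E3) (v : Fin 7 → ℝ → E3 → E3) (q : Fin 7 → ℝ → E3 → ℝ) :
    Prop :=
  ∀ i, (ContDiffOn ℝ (⊤ : ℕ∞) (Function.uncurry (v i)) (Set.Iio 0 ×ˢ Set.univ) ∧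
    ContDiffOn ℝ (⊤ : ℕ∞) (Function.uncurry (q i)) (Set.Iio 0 ×ˢ Set.univ) ∧
    (∃ K : ℝ, ∀ t < 0, ∀ x, ‖(v i) t x‖ ≤ K * (1 + (-t)⁻¹) * (1 + ‖x‖) ∧
      |(q i) t x| ≤ K / (-t) + K * (1 + ‖x‖) / Real.sqrt (-t) ^ 3) ∧
    (∀ t < 0, VectorCalculus.IsDivFree ((v i) t)) ∧
    (∀ t < 0, ∀ x, timeDeriv (v i) t x + convect (u t) ((v i) t) x + convect ((v i) t) (u t) x =
      Laplacian.laplacian ((v i) t) x - gradient ((q i) t) x))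

/-- `1/√s ≤ 1 + 1/s` for `s > 0`. -/
theorem one_div_sqrt_le {s : ℝ} (hs : 0 < s) : 1 / Real.sqrt s ≤ 1 + s⁻¹ := by
  have hr : 0 < Real.sqrt s := Real.sqrt_pos.2 hs
  have hss : Real.sqrt s * Real.sqrt s = s := Real.mul_self_sqrt hs.le
  have key : s⁻¹ * Real.sqrt s = (Real.sqrt s)⁻¹ := by
    calc s⁻¹ * Real.sqrt s = (Real.sqrt s * Real.sqrt s)⁻¹ * Real.sqrt s := by rw [hss]
      _ = (Real.sqrt s)⁻¹ := by rw [mul_inv, mul_assoc, inv_mul_cancel₀ hr.ne', mul_one]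
  rw [div_le_iff₀ hr, add_mul, one_mul, key]
  by_cases h1 : 1 ≤ Real.sqrt s
  · linarith [inv_nonneg.2 hr.le]
  · have : 1 ≤ (Real.sqrt s)⁻¹ := (one_le_inv₀ hr).2 (le_of_lt (not_le.1 h1))
    linarith

/-- The weakened class contains the tempered class (so (b) below is an honest weakening). -/
theorem sevenLinearGrowth_of_sevenTempered {u : ℝ → E3 → E3} {v : Fin 7 → ℝ → E3 → E3}
    {q : Fin 7 → ℝ → E3 → ℝ} (h : SevenTempered u v q) : SevenLinearGrowth u v q := by
  intro i
  obtain ⟨h1, h2, ⟨K, hK⟩, h4, h5⟩ := h i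
  refine ⟨h1, h2, ⟨2 * |K|, fun t ht x => ⟨?_, ?_⟩⟩, h4, h5⟩
  · have hnt : 0 < -t := by linarith
    have hv := (hK t ht x).1
    have hK' : K ≤ |K| := le_abs_self K
    have hx : 0 ≤ ‖x‖ := norm_nonneg x
    have hsq := one_div_sqrt_le hnt
    have hspos : 0 < 1 / Real.sqrt (-t) := by positivity
    calc ‖v i t x‖ ≤ K / Real.sqrt (-t) + K * (1 + ‖x‖) / (-t) := hv
      _ ≤ |K| / Real.sqrt (-t) + |K| * (1 + ‖x‖) / (-t) := by gcongr
      _ = |K| * (1 / Real.sqrt (-t)) * 1 + |K| * (-t)⁻¹ * (1 + ‖x‖) := by ring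
      _ ≤ |K| * (1 + (-t)⁻¹) * (1 + ‖x‖) + |K| * (1 + (-t)⁻¹) * (1 + ‖x‖) := by
          gcongr
          · linarith
          · linarith [inv_pos.2 hnt]
      _ = 2 * |K| * (1 + (-t)⁻¹) * (1 + ‖x‖) := by ring
  · have hnt : 0 < -t := by linarith
    have hq := (hK t ht x).2
    have hK' : K ≤ 2 * |K| := by linarith [le_abs_self K, abs_nonneg K]
    have hs3 : 0 < Real.sqrt (-t) ^ 3 := pow_pos (Real.sqrt_pos.2 hnt) 3
    calc |q i t x| ≤ K / (-t) + K * (1 + ‖x‖) / Real.sqrt (-t) ^ 3 := hq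
      _ ≤ 2 * |K| / (-t) + 2 * |K| * (1 + ‖x‖) / Real.sqrt (-t) ^ 3 := by gcongr

/-- The crux with the tempered velocity bound weakened to locally-uniform linear growth. -/
def LinearLiouvilleSevenWithoutBackwardDecay : Prop :=
  ∀ C u, InClassA C u → ∀ v q, SevenLinearGrowth u v q → DependentModSlice v

/-- A time-independent linear mode `v(t, x) = L x` (pressure `0`). -/
def linV (L : E3 →L[ℝ] E3) : ℝ → E3 → E3 := fun _ x => L x

/-- Slices of a linear mode. -/
theorem linV_apply (L : E3 →L[ℝ] E3) (t : ℝ) : linV L t = ⇑L := rfl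

/-- A linear field is harmonic. -/
theorem laplacian_clm (L : E3 →L[ℝ] E3) (x : E3) : Δ (⇑L : E3 → E3) x = 0 := by
  have h1 : fderiv ℝ (⇑L : E3 → E3) = fun _ => L := funext fun y => L.fderiv
  rw [InnerProductSpace.laplacian_eq_iteratedFDeriv_stdOrthonormalBasis]
  simp [iteratedFDeriv_two_apply, h1]

/-- The divergence of a linear field is its trace, computed in the standard basis. -/
theorem divergence_clm (L : E3 →L[ℝ] E3) (x : E3) :
    VectorCalculus.divergence (⇑L : E3 → E3) x =
      ∑ i, ⟪EuclideanSpace.single i (1 : ℝ), L (EuclideanSpace.single i 1)⟫ := by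
  rw [divergence_eq_sum_inner_fderiv (EuclideanSpace.basisFun (Fin 3) ℝ), L.fderiv]
  simp

/-- Linear modes with `tr L = 0` are classical Stokes solutions in the linear-growth class. -/
theorem linV_sevenLinearGrowth_clause (L : E3 →L[ℝ] E3)
    (htr : ∑ i, ⟪EuclideanSpace.single i (1 : ℝ), L (EuclideanSpace.single i 1)⟫ = 0) :
    (ContDiffOn ℝ (⊤ : ℕ∞) (Function.uncurry (linV L)) (Set.Iio 0 ×ˢ Set.univ) ∧
    ContDiffOn ℝ (⊤ : ℕ∞) (Function.uncurry (fun (_ : ℝ) (_ : E3) => (0 : ℝ))) (Set.Iio 0 ×ˢ Set.univ) ∧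
    (∃ K : ℝ, ∀ t < 0, ∀ x, ‖(linV L) t x‖ ≤ K * (1 + (-t)⁻¹) * (1 + ‖x‖) ∧
      |(fun (_ : ℝ) (_ : E3) => (0 : ℝ)) t x| ≤ K / (-t) + K * (1 + ‖x‖) / Real.sqrt (-t) ^ 3) ∧
    (∀ t < 0, VectorCalculus.IsDivFree ((linV L) t)) ∧
    (∀ t < 0, ∀ x, timeDeriv (linV L) t x + convect ((0 : ℝ → E3 → E3) t) ((linV L) t) x +
      convect ((linV L) t) ((0 : ℝ → E3 → E3) t) x =
      Laplacian.laplacian ((linV L) t) x - gradient ((fun (_ : ℝ) (_ : E3) => (0 : ℝ)) t) x)) := by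
  refine ⟨?_, contDiffOn_const, ⟨‖L‖, fun t ht x => ⟨?_, ?_⟩⟩, ?_, ?_⟩
  · change ContDiffOn ℝ (⊤ : ℕ∞) (fun p : ℝ × E3 => L p.2) (Set.Iio 0 ×ˢ Set.univ)
    exact (L.contDiff.comp contDiff_snd).contDiffOn
  · have hnt : 0 < -t := by linarith
    show ‖L x‖ ≤ _
    calc ‖L x‖ ≤ ‖L‖ * ‖x‖ := L.le_opNorm x
      _ = ‖L‖ * 1 * ‖x‖ := by ring
      _ ≤ ‖L‖ * (1 + (-t)⁻¹) * (1 + ‖x‖) := by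
          gcongr
          · linarith [inv_pos.2 hnt]
          · linarith
  · have hnt : 0 < -t := by linarith
    simp only [abs_zero]
    positivity
  · intro t _ x
    show VectorCalculus.divergence (⇑L) x = 0
    rw [divergence_clm, htr]
  · intro t _ x
    have e1 : timeDeriv (linV L) t x = 0 := by simp [timeDeriv, linV]
    have e2 : convect ((0 : ℝ → E3 → E3) t) ((linV L) t) x = 0 := by simp [convect]
    have e3 : convect ((linV L) t) ((0 : ℝ → E3 → E3) t) x = 0 := by simp [convect]
    have e4 : Δ ((linV L) t) x = 0 := by rw [linV_apply, laplacian_clm]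
    have e5 : gradient ((fun (_ : ℝ) (_ : E3) => (0 : ℝ)) t) x = 0 := by
      show gradient (fun _ : E3 => (0 : ℝ)) x = 0
      exact gradient_fun_const x 0
    rw [e1, e2, e3, e4, e5]; simp

/-- The elementary map `x ↦ x_b e_a`. -/
def eMap (a b : Fin 3) : E3 →L[ℝ] E3 :=
  (EuclideanSpace.proj b).smulRight (EuclideanSpace.single a (1 : ℝ))

/-- Unfolding the elementary map. -/
theorem eMap_apply (a b : Fin 3) (x : E3) : eMap a b x = x b • EuclideanSpace.single a 1 := rfl

/-- Seven traceless linear maps (six off-diagonal elementary maps and `diag(1, −1, 0)`). -/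
def affL : Fin 7 → (E3 →L[ℝ] E3) :=
  ![eMap 0 1, eMap 0 2, eMap 1 0, eMap 1 2, eMap 2 0, eMap 2 1, eMap 0 0 - eMap 1 1]

/-- The seven maps are traceless. -/
theorem affL_traceless (i : Fin 7) :
    ∑ j, ⟪EuclideanSpace.single j (1 : ℝ), affL i (EuclideanSpace.single j 1)⟫ = 0 := by
  fin_cases i <;>
    simp [affL, Fin.sum_univ_three, eMap_apply, EuclideanSpace.inner_single_left,
      inner_sub_right]

/-- The affine seven-family `v_i(t, x) = L_i x`, pressures `0`. -/
def affFamilyV (i : Fin 7) : ℝ → E3 → E3 := linV (affL i)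
/-- Zero pressures. -/
def affFamilyQ (_ : Fin 7) : ℝ → E3 → ℝ := fun _ _ => 0

/-- Unfolding the affine family. -/
theorem affFamilyV_apply (i : Fin 7) (t : ℝ) (x : E3) : affFamilyV i t x = affL i x := rfl

/-- The affine family satisfies the weakened seven-family hypothesis about `u = 0`. -/
theorem affFamily_sevenLinearGrowth : SevenLinearGrowth 0 affFamilyV affFamilyQ := fun i =>
  linV_sevenLinearGrowth_clause (affL i) (affL_traceless i)

/-- The affine family is independent modulo slice-wise constants (one time sample). -/
theorem affFamily_indep_modSlice (c : Fin 7 → ℝ)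
    (h : ∀ t < 0, ∃ b : E3, ∀ x : E3, ∑ i, c i • affFamilyV i t x = b) : c = 0 := by
  obtain ⟨b, hb⟩ := h (-1) (by norm_num)
  have hb0 : b = 0 := by
    rw [← hb 0]
    simp [affFamilyV_apply]
  subst hb0
  have k0 := hb (EuclideanSpace.single 0 1)
  have k1 := hb (EuclideanSpace.single 1 1)
  have k2 := hb (EuclideanSpace.single 2 1)
  have k00 := congrArg (fun w : E3 => ⟪EuclideanSpace.single (0 : Fin 3) (1 : ℝ), w⟫) k0
  have k01 := congrArg (fun w : E3 => ⟪EuclideanSpace.single (1 : Fin 3) (1 : ℝ), w⟫) k0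
  have k02 := congrArg (fun w : E3 => ⟪EuclideanSpace.single (2 : Fin 3) (1 : ℝ), w⟫) k0
  have k10 := congrArg (fun w : E3 => ⟪EuclideanSpace.single (0 : Fin 3) (1 : ℝ), w⟫) k1
  have k11 := congrArg (fun w : E3 => ⟪EuclideanSpace.single (1 : Fin 3) (1 : ℝ), w⟫) k1
  have k12 := congrArg (fun w : E3 => ⟪EuclideanSpace.single (2 : Fin 3) (1 : ℝ), w⟫) k1
  have k20 := congrArg (fun w : E3 => ⟪EuclideanSpace.single (0 : Fin 3) (1 : ℝ), w⟫) k2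
  have k21 := congrArg (fun w : E3 => ⟪EuclideanSpace.single (1 : Fin 3) (1 : ℝ), w⟫) k2
  simp [Fin.sum_univ_seven, affFamilyV_apply, affL, eMap_apply, inner_add_right,
    inner_smul_right, EuclideanSpace.inner_single_left] at k00 k01 k02 k10 k11 k12 k20 k21
  funext i
  fin_cases i <;> simp <;> linarith

/-- **Load-bearing (b).** Any proof of the crux must use the decay of the tempered class as
`t → −∞`: with locally-uniform linear growth instead, the affine modes refute it at `u = 0`. -/
theorem linearLiouvilleSeven_false_without_backward_decay :
    ¬ LinearLiouvilleSevenWithoutBackwardDecay := by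
  intro h
  obtain ⟨c, hc, hdep⟩ := h 0 0 (inClassA_zero le_rfl) affFamilyV affFamilyQ
    affFamily_sevenLinearGrowth
  exact hc (affFamily_indep_modSlice c hdep)




end Summit.NavierStokesRegularity.NavierStokesRegularity.Theorems.LinearLiouvilleSeven.Negative

end
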